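import Literature.AnabelianGeometry.SemiGraphs.IwahoriTranslationCharacter
import Literature.AnabelianGeometry.SemiGraphs.ArithTotalEstrangementLoopGraphBranchTransport
import Literature.AnabelianGeometry.SemiGraphs.WitnessIwahoriDouble
import Literature.AnabelianGeometry.SemiGraphs.ArithDecompositionDataProofs
import Mathlib.FieldTheory.Finite.Basic
import HarnessLib

/-!
# [SemiAnbd] Def 5.3 (ii) / Thm 5.4 at the SEGMENT `𝒟₁ = doubleLoop p`: total arithmetic estrangement is
# IMPOSSIBLE under branch transport whenever the `(p − 1)`-torsion characters of `Π_A` have open kernels —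
# in particular for `p = 2` outright (surrogate-carrier obstruction, sequel of the loop-graph case)

Mochizuki, *Semi-graphs of anabelioids*, Publ. RIMS **42** (2006) 221–322, §5: Def. 5.3 (ii) p. 65 (clause
(B): "… or `b' = b` and `g ∉ Π^temp_{𝔊,b}`, fails to be arithmetically ample"), Thm. 5.4 p. 66 (frame:
Def. 5.1 (i) — the arithmetic action transports the decomposition groups and does not switch branches),
Ex. 5.6 p. 67. [cite: MochizukiSemiAnbd2006, Def 5.3 (ii), p. 65]

PROOF-ONLY file (abc-iut cell, layer L3, T54 board, row «HEST@SEGMENT-CHARACTER» — the sequel named in the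
ERRATUM of `HOME/staging/f/f-177/g8/T54-CARRIER-SHAPES.md`; seat abc-iut-f-177 gen 9).  No definition, no new
named fact; every input is consumed BY NAME (file (A): `IwahoriTranslationCharacter.lean`).

THE RESULT.  After `IwahoriWitness.not_isTotallyArithEstranged_loopGraph_of_branchTransport` (p470380: at the
loop `𝓛 = loopGraph p` the T54 binders `{hBR, noSwitchBase, hest}` are jointly uninhabited), the only with-edge
Thm-3.7 witness of the tree left as a surrogate carrier for `hest` was abc-iut-f-175's SEGMENT
`𝒟₁ = IwahoriWitness.doubleLoop p` (`v₀ —— v₁`, `Π_{v_i} = P = ℤ_p ⋊ (1 + pℤ_p)`, both branch groups the torus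
`T_0`; one branch per vertex, so only clause (B) of Def. 5.3 (ii) has content).  For every `Π_A`, every outer
action `ρ' : Π_A → Out(π₁^temp 𝒟₁)` with base action `baseAct` under the frame's own DESIGN binder `hBR` (branch
transport, verbatim the shape of abc-iut-w4-d029's capstone v8 p449794) and `noSwitchBase` (which here forces
`baseAct = 1`, `baseAct_eq_one_of_noBranchSwitching`), and every choice `Rc` of §3 representatives:
`not_isTotallyArithEstranged_doubleLoop_of_branchTransport` — `hest` FAILS as soon as every subgroup of `Π_A` of
index dividing `p − 1` is open; `…_of_eq_two` — for `p = 2` OUTRIGHT; `…_of_finiteIndex_isOpen` — for every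
STRONGLY COMPLETE `Π_A` (all finite-index subgroups open: e.g. topologically finitely generated profinite `Π_A`
[Nikolov–Segal], the currency of FACT F-1977 — in particular `G_K` of a `p`-adic local field, the `Π_A` of Ex. 5.6).

MECHANISM (file (A) `IwahoriTranslationCharacter.lean`).  By `hBR` + Prop. 3.2 every `a ∈ Π_A` has a
representative of `ρ'(a)` stabilising `χ₀(P)` AND `χ₀(T_0)` (`exists_stabilizing_lift_doubleLoop`), so the
stabiliser `St` of this pair in `E = π₁^temp(𝒟₁) ⋊^out Π_A` surjects onto `Π_A`; every `γ ∈ St` induces an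
automorphism of `P` (Thm. 3.7 (i): `χ₀` injective) acting on the CHARACTERISTIC translation subgroup
`ℤ_p × 1 = C_P([P,P])` by a unit `Λ(γ)` (`Iw.exists_translationCharacter`).  The translation
`g := ι χ₀(1,1) ∈ Π^temp_{𝔊,v₀}` does not commensurate `χ₀(T_0)` (malnormal torus; temp-slimness for `ι`
injective), so clause (B) asks `Π^temp_{𝔊,b₀} ∩ g Π^temp_{𝔊,b₀} g⁻¹` to be non-ample; but for `Λ(γ) ≡ 1 (mod p)`,
`Λ(γ)⁻¹ = 1 + p s`, the element `ι(χ₀ b_0(s)) · γ` lies in that intersection (`Iw.map_realign_eq`), whose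
augmentation image thus contains the image of `Ker(Λ mod p)` — index dividing `|𝔽_pˣ| = p − 1`, open by
hypothesis: the intersection IS arithmetically ample.

HONEST SCOPE.  A statement about OUR surrogate carrier family (the Iwahori witnesses), labelled
«surrogate-carrier obstruction»: with p470380, no Thm-3.7 witness with an edge currently in the tree hosts a
contentful `hest` under the T54 frame with a strongly complete `Π_A`; the residual surrogate is `𝒟₁` with `p`
odd AND an outer action whose induced `𝔽_pˣ`-valued translation character has a non-open kernel.  A contentful
`hest` needs print's Ex. 5.6 shape (the cell's GAP «Ex 5.6 genuine carrier»).  Nothing here asserts or denies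
anything about print's Ex. 5.6 or about [IUTchIII] Cor. 3.12; typed ≠ proved elsewhere.
-/

noncomputable section

namespace Literature.AnabelianGeometry.SemiGraphs

open Literature.AnabelianGeometry.EtaleTheta CategoryTheory Topology


/-! ### 1. The segment `𝒟₁ = doubleLoop p`: the base action is trivial, stabilising lifts -/

namespace IwahoriWitness

open ProfiniteSemiGraph

variable (p : ℕ) [Fact p.Prime] (c : TemperedPiChart (doubleLoop p)) {PA : Type*} [Group PA]
  (ρ' : PA →* TopOut c.G) (baseAct : PA →* Aut (doubleLoop p).graph)

/-- **No branch switching on the segment forces the trivial base action**: an automorphism of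
`v₀ —— v₁` fixing both branches of its edge fixes everything. [cite: MochizukiSemiAnbd2006, Thm 5.4 p.66] -/
theorem baseAct_eq_one_of_noBranchSwitching
    (noSwitchBase : NoBranchSwitching (doubleLoop p).graph.edgeOf
      (fun (a : PA) (b : (doubleLoop p).graph.Branch) => (baseAct a).hom.branchMap b))
    (a : PA) : baseAct a = 1 := by
  haveI : Subsingleton (doubleLoop p).graph.Edge := inferInstanceAs (Subsingleton PUnit)
  have hb : ∀ b : (doubleLoop p).graph.Branch, (baseAct a).hom.branchMap b = b :=
    fun b => noSwitchBase a b (Subsingleton.elim _ _)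
  apply CategoryTheory.Iso.ext
  apply SemiGraph.hom_ext
  · funext v
    have h := (baseAct a).hom.abuts_branchMap v v rfl
    rw [hb] at h
    exact (Option.some.inj h).symm
  · funext e
    exact Subsingleton.elim _ _
  · funext b
    exact hb b

section BranchTransport

variable
  (hBR : ∀ (a : PA) (b : (doubleLoop p).graph.Branch) (v : (doubleLoop p).graph.Vertex)
      (hb : (doubleLoop p).graph.abuts b = some v) (φ : (doubleLoop p).Gv v →ₜ* c.G),
      IsVerticialHom c v φ →
      ∃ Φ : contMulAut c.G, TopOut.mk _ Φ = ρ' a ∧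
        ∃ φ' : (doubleLoop p).Gv ((baseAct a).hom.vertexMap v) →ₜ* c.G,
          IsVerticialHom c ((baseAct a).hom.vertexMap v) φ' ∧
          ∃ x' : c.G,
            Subgroup.map (Φ : MulAut c.G).toMonoidHom φ.toMonoidHom.range =
              Subgroup.map (MulAut.conj x').toMonoidHom φ'.toMonoidHom.range ∧
            Subgroup.map (Φ : MulAut c.G).toMonoidHom
                (Subgroup.map φ.toMonoidHom ((doubleLoop p).branchSubgroup b v hb)) =
              Subgroup.map (MulAut.conj x').toMonoidHom
                (Subgroup.map φ'.toMonoidHom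
                  ((doubleLoop p).branchSubgroup ((baseAct a).hom.branchMap b)
                    ((baseAct a).hom.vertexMap v) ((baseAct a).hom.abuts_branchMap b v hb))))
  (noSwitchBase : NoBranchSwitching (doubleLoop p).graph.edgeOf
      (fun (a : PA) (b : (doubleLoop p).graph.Branch) => (baseAct a).hom.branchMap b))

/-- Re-alignment of a transported verticial homomorphism (Prop. 3.2): from `Φ(χ P) = γ_{x'}(φ' P)` and
`Φ(χ T_0) = γ_{x'}(φ' T_0)` with `φ'` verticial at the same vertex, a representative of the same outer class
stabilising `χ P` and `χ T_0`. [cite: MochizukiSemiAnbd2006, Prop 3.2 p.35] -/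
private theorem realign {v : (doubleLoop p).graph.Vertex} (χ φ' : (doubleLoop p).Gv v →ₜ* c.G)
    (hχ : IsVerticialHom c v χ) (hφ' : IsVerticialHom c v φ') (Φ : contMulAut c.G) (x' : c.G) (a : PA)
    (hΦ : TopOut.mk _ Φ = ρ' a)
    (h1 : (χ.toMonoidHom.range).map (Φ : MulAut c.G).toMonoidHom =
      (φ'.toMonoidHom.range).map (MulAut.conj x').toMonoidHom)
    (h2 : (((Iw.bHom (0 : ℤ_[p])).toMonoidHom.range).map χ.toMonoidHom).map (Φ : MulAut c.G).toMonoidHom =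
      (((Iw.bHom (0 : ℤ_[p])).toMonoidHom.range).map φ'.toMonoidHom).map (MulAut.conj x').toMonoidHom) :
    ∃ Φ₀ : contMulAut c.G, TopOut.mk _ Φ₀ = ρ' a ∧
      (χ.toMonoidHom.range).map (Φ₀ : MulAut c.G).toMonoidHom = χ.toMonoidHom.range ∧
      (((Iw.bHom (0 : ℤ_[p])).toMonoidHom.range).map χ.toMonoidHom).map (Φ₀ : MulAut c.G).toMonoidHom =
        ((Iw.bHom (0 : ℤ_[p])).toMonoidHom.range).map χ.toMonoidHom := by
  haveI := c.isTopologicalGroup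
  obtain ⟨z, hz⟩ := exists_conj_of_isVerticialHom c χ φ' hχ hφ'
  have hr : φ'.toMonoidHom.range = (χ.toMonoidHom.range).map (MulAut.conj z).toMonoidHom :=
    (SubgroupMulAut.range_map_conj_eq_of_forall χ.toMonoidHom φ'.toMonoidHom z (fun y => (hz y).symm)).symm
  have hb : ((Iw.bHom (0 : ℤ_[p])).toMonoidHom.range).map φ'.toMonoidHom =
      (((Iw.bHom (0 : ℤ_[p])).toMonoidHom.range).map χ.toMonoidHom).map (MulAut.conj z).toMonoidHom :=
    (SubgroupMulAut.map_map_conj_eq_of_forall χ.toMonoidHom φ'.toMonoidHom z (fun y => (hz y).symm) _).symm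
  rw [hr] at h1
  rw [hb] at h2
  -- for ANY `S`: `γ_{(x'z)⁻¹} (γ_{x'} (γ_z S)) = S`
  have hkey : ∀ S : Subgroup c.G, ((S.map (MulAut.conj z).toMonoidHom).map (MulAut.conj x').toMonoidHom).map
      (((toOuterSemidirectProduct ρ' (x' * z)⁻¹).1.1 : contMulAut c.G) : MulAut c.G).toMonoidHom = S := by
    intro S
    rw [show (((toOuterSemidirectProduct ρ' (x' * z)⁻¹).1.1 : contMulAut c.G) : MulAut c.G) =
        MulAut.conj (x' * z)⁻¹ from rfl,
      ← SubgroupMulAut.map_mul, ← SubgroupMulAut.map_mul, ← map_mul, ← map_mul, mul_assoc, inv_mul_cancel, map_one]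
    exact SubgroupMulAut.map_one _
  refine ⟨(toOuterSemidirectProduct ρ' (x' * z)⁻¹).1.1 * Φ, ?_, ?_, ?_⟩
  · rw [map_mul, mk_fst_eq_rho_snd ρ' (toOuterSemidirectProduct ρ' _),
      outerSemidirectProductSnd_toOuterSemidirectProduct, map_one, one_mul, hΦ]
  · rw [Subgroup.coe_mul, SubgroupMulAut.map_mul, h1]; exact hkey _
  · rw [Subgroup.coe_mul, SubgroupMulAut.map_mul, h2]; exact hkey _

include hBR noSwitchBase

/-- **Stabilising lifts from branch transport at the segment.**  Under `hBR` + `noSwitchBase`, for every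
`a ∈ Π_A`, every branch `β` abutting to `v` and every verticial `χ : P → π₁^temp(𝒟₁)` at `v` there is a
representative `Φ` of `ρ'(a)` with `Φ(χ P) = χ P` and `Φ(χ T_0) = χ T_0`.
[cite: MochizukiSemiAnbd2006, Prop 3.6 (iv), p. 39] -/
theorem exists_stabilizing_lift_doubleLoop (a : PA) (β : (doubleLoop p).graph.Branch)
    (v : (doubleLoop p).graph.Vertex) (hβ : (doubleLoop p).graph.abuts β = some v)
    (χ : (doubleLoop p).Gv v →ₜ* c.G) (hχ : IsVerticialHom c v χ) :
    ∃ Φ : contMulAut c.G, TopOut.mk _ Φ = ρ' a ∧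
      (χ.toMonoidHom.range).map (Φ : MulAut c.G).toMonoidHom = χ.toMonoidHom.range ∧
      (((Iw.bHom (0 : ℤ_[p])).toMonoidHom.range).map χ.toMonoidHom).map (Φ : MulAut c.G).toMonoidHom =
        ((Iw.bHom (0 : ℤ_[p])).toMonoidHom.range).map χ.toMonoidHom := by
  have key := hBR a β v hβ χ hχ
  rw [baseAct_eq_one_of_noBranchSwitching p baseAct noSwitchBase a] at key
  obtain ⟨Φ, hΦ, φ', hφ', x', h1, h2⟩ := key
  simp only [doubleLoop_branchSubgroup, coeff_torusBranch] at h2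
  exact realign p c ρ' χ φ' hχ hφ' Φ x' a hΦ h1 h2

/-! ### 2. The obstruction at `𝒟₁` -/

/-- **[SemiAnbd] Def 5.3 (ii) FAILS at the segment `𝒟₁ = doubleLoop p` for every outer action under branch
transport whose `(p − 1)`-torsion characters have open kernels** («surrogate-carrier obstruction», sequel of
`IwahoriWitness.not_isTotallyArithEstranged_loopGraph_of_branchTransport`): for every `Π_A`, every
`ρ' : Π_A → Out(π₁^temp 𝒟₁)` with base action `baseAct` satisfying `hBR` + `noSwitchBase`, and every choice `Rc`
of §3 representatives, if every subgroup of `Π_A` of index dividing `p − 1` is open then the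
commensurator-produced decomposition data of `π₁^temp(𝒟₁) ⋊^out Π_A` are NOT totally arithmetically estranged —
clause (B) («`b' = b`, `g ∉ Π^temp_{𝔊,b}`») dies at the translation `g = ι χ₀(1,1)`: the augmentation image of
`Π^temp_{𝔊,b₀} ∩ g Π^temp_{𝔊,b₀} g⁻¹` contains the image of the kernel of the translation character mod `p`
(see the module docstring). [cite: MochizukiSemiAnbd2006, Def 5.3 (ii), p. 65] -/
theorem not_isTotallyArithEstranged_doubleLoop_of_branchTransport [TopologicalSpace PA]
    [IsTopologicalGroup PA]
    (hfio : ∀ H : Subgroup PA, H.index ∣ (p - 1) → IsOpen (H : Set PA))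
    (Rc : ChartRepresentatives c) :
    ¬ IsTotallyArithEstranged (decompositionDataOfChart Rc (toOuterSemidirectProduct ρ'))
      (outerSemidirectProductSnd ρ') := by
  haveI := c.isTopologicalGroup
  intro hest
  -- combinatorics of the segment
  let v₀ : (doubleLoop p).graph.Vertex := ⟨false⟩
  let b₀ : (doubleLoop p).graph.Branch := ⟨false⟩
  have hb₀ : (doubleLoop p).graph.abuts b₀ = some v₀ := rfl
  have h37 := doubleLoop_thm37Hypotheses p
  have hG := doubleLoop_isGraph p
  have hCV : CompactInVerticialAt (doubleLoop p) := compactInVerticialAt_of_finiteGraph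
  -- the representatives through ONE verticial `χ₀`
  have hHv := Rc.Hv_mem v₀
  obtain ⟨ψ, hψ, -⟩ := Rc.Hv_mem v₀
  obtain ⟨β₀, hβ₀, x₀, -, hH₀, hK₀⟩ := exists_branch_presentation_of_edgeLike_le_verticialAt hCV h37 hG c
    (Rc.Hb_mem b₀) hHv (Rc.Hb_le b₀ v₀ hb₀) ψ hψ
  simp only [doubleLoop_branchSubgroup, coeff_torusBranch] at hK₀
  obtain ⟨χ₀, hχ₀, hχ₀eq⟩ := exists_isVerticialHom_conj c ψ hψ x₀
  have hH : Rc.Hv v₀ = χ₀.toMonoidHom.range := by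
    rw [hH₀]; exact SubgroupMulAut.range_map_conj_eq_of_forall ψ.toMonoidHom χ₀.toMonoidHom x₀ hχ₀eq
  have hK : Rc.Hb b₀ = ((Iw.bHom (0 : ℤ_[p])).toMonoidHom.range).map χ₀.toMonoidHom := by
    rw [hK₀]; exact SubgroupMulAut.map_map_conj_eq_of_forall ψ.toMonoidHom χ₀.toMonoidHom x₀ hχ₀eq _
  -- injectivity of `χ₀` (Thm 3.7 (i)) and of `ι` (temp-slimness, Prop 3.6 (iv))
  have hχinj : Function.Injective χ₀.toMonoidHom := (verticialInjective_holds _ h37 c v₀).2 χ₀ hχ₀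
  have hZ : Subgroup.center c.G = ⊥ :=
    center_eq_bot_of_isSlimGroup (temperedPiSlim_holds _ h37.toProp36Hypotheses c)
  have hιinj : Function.Injective (toOuterSemidirectProduct ρ') := toOuterSemidirectProduct_injective ρ' hZ
  -- the element `g = ι χ₀ (1, 1)`
  set g : outerSemidirectProduct ρ' := toOuterSemidirectProduct ρ' (χ₀.toMonoidHom (⟨1, 0⟩ : Iw p)) with hgdef
  have hgv : g ∈ arithVertGp Rc (toOuterSemidirectProduct ρ') v₀ := by
    refine mem_arithVertGp_of_map_eq c ρ' Rc g ?_
    rw [hH]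
    exact SubgroupMulAut.map_conj_of_mem ⟨(⟨1, 0⟩ : Iw p), rfl⟩
  have hgb : g ∉ arithBrGp Rc (toOuterSemidirectProduct ρ') b₀ := by
    rw [arithBrGp_of_abuts Rc _ hb₀]
    intro hmem
    have h2 := (Subgroup.mem_inf.mp hmem).2
    rw [hK, hgdef, map_mem_commensurator_map_iff hιinj, map_mem_commensurator_map_iff hχinj] at h2
    exact Iw.one_zero_not_mem_commensurator h2
  -- the stabiliser of `(χ₀ P, χ₀ T_0)` in `E = π₁^temp(𝒟₁) ⋊^out Π_A`
  let St : Subgroup (outerSemidirectProduct ρ') :=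
    { carrier := {γ | (χ₀.toMonoidHom.range).map ((γ : contMulAut c.G × PA).1 : MulAut c.G).toMonoidHom =
          χ₀.toMonoidHom.range ∧
        (((Iw.bHom (0 : ℤ_[p])).toMonoidHom.range).map χ₀.toMonoidHom).map ((γ : contMulAut c.G × PA).1 : MulAut c.G).toMonoidHom =
          ((Iw.bHom (0 : ℤ_[p])).toMonoidHom.range).map χ₀.toMonoidHom}
      one_mem' := ⟨SubgroupMulAut.map_one _, SubgroupMulAut.map_one _⟩
      mul_mem' := by
        rintro γ γ' ⟨h1, h2⟩ ⟨h1', h2'⟩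
        constructor
        · change (χ₀.toMonoidHom.range).map
            (((γ : contMulAut c.G × PA).1 : MulAut c.G) * ((γ' : contMulAut c.G × PA).1 : MulAut c.G)).toMonoidHom = _
          rw [SubgroupMulAut.map_mul, h1', h1]
        · change (((Iw.bHom (0 : ℤ_[p])).toMonoidHom.range).map χ₀.toMonoidHom).map
            (((γ : contMulAut c.G × PA).1 : MulAut c.G) * ((γ' : contMulAut c.G × PA).1 : MulAut c.G)).toMonoidHom = _
          rw [SubgroupMulAut.map_mul, h2', h2]
      inv_mem' := by
        rintro γ ⟨h1, h2⟩
        constructor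
        · change (χ₀.toMonoidHom.range).map (((γ : contMulAut c.G × PA).1 : MulAut c.G)⁻¹).toMonoidHom = _
          exact SubgroupMulAut.map_inv_of_map_eq h1
        · change (((Iw.bHom (0 : ℤ_[p])).toMonoidHom.range).map χ₀.toMonoidHom).map (((γ : contMulAut c.G × PA).1 : MulAut c.G)⁻¹).toMonoidHom = _
          exact SubgroupMulAut.map_inv_of_map_eq h2 }
  have hStmem : ∀ γ : outerSemidirectProduct ρ', γ ∈ St ↔
      (χ₀.toMonoidHom.range).map ((γ : contMulAut c.G × PA).1 : MulAut c.G).toMonoidHom =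
          χ₀.toMonoidHom.range ∧
        (((Iw.bHom (0 : ℤ_[p])).toMonoidHom.range).map χ₀.toMonoidHom).map ((γ : contMulAut c.G × PA).1 : MulAut c.G).toMonoidHom =
          ((Iw.bHom (0 : ℤ_[p])).toMonoidHom.range).map χ₀.toMonoidHom := fun γ => Iff.rfl
  -- the action of `E` on `π₁^temp(𝒟₁)` through the `Aut`-component
  let α : outerSemidirectProduct ρ' →* MulAut c.G :=
    (contMulAut c.G).subtype.comp ((MonoidHom.fst _ _).comp (outerSemidirectProduct ρ').subtype)
  have hα : ∀ γ : outerSemidirectProduct ρ', α γ = ((γ : contMulAut c.G × PA).1 : MulAut c.G) := fun _ => rfl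
  -- the translation character on `St`
  obtain ⟨Λ, hΛ⟩ := Iw.exists_translationCharacter α χ₀.toMonoidHom hχinj St
    (fun γ hγ => by rw [hα]; exact (hStmem γ).1 hγ)
  let Λp : St →* (ZMod p)ˣ := (Units.map (PadicInt.toZMod (p := p)).toMonoidHom).comp Λ
  -- `St → Π_A` is onto (stabilising lifts)
  let f : St →* PA := (outerSemidirectProductSnd ρ').comp St.subtype
  have hfsurj : Function.Surjective f := fun a => by
    obtain ⟨Φ₀, hmk, hH', hK'⟩ :=
      exists_stabilizing_lift_doubleLoop p c ρ' baseAct hBR noSwitchBase a b₀ v₀ hb₀ χ₀ hχ₀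
    exact ⟨⟨⟨(Φ₀, a), hmk⟩, (hStmem _).2 ⟨hH', hK'⟩⟩, rfl⟩
  -- the open subgroup `U = aug (Ker Λ mod p)` of index dividing `p - 1`
  have hcard : Nat.card (ZMod p)ˣ = p - 1 := by
    rw [Nat.card_eq_fintype_card]; convert ZMod.card_units p
  have hidx : (Λp.ker.map f).index ∣ (p - 1) := by
    refine (Λp.ker.index_map_dvd hfsurj).trans ?_
    rw [Subgroup.index_ker, ← hcard]
    exact Subgroup.card_subgroup_dvd_card _
  have hUopen : IsOpen ((Λp.ker.map f : Subgroup PA) : Set PA) := hfio _ hidx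
  -- `U ≤ aug (Π^temp_{𝔊,b₀} ∩ g Π^temp_{𝔊,b₀} g⁻¹)`
  have hle : Λp.ker.map f ≤ (arithBrGp Rc (toOuterSemidirectProduct ρ') b₀ ⊓
      conjSubgroup g (arithBrGp Rc (toOuterSemidirectProduct ρ') b₀)).map (outerSemidirectProductSnd ρ') := by
    rintro _ ⟨γ, hγ, rfl⟩
    obtain ⟨θ, hθ, hθT, hθl⟩ := hΛ γ
    -- `Λ γ ≡ 1 (mod p)`
    have hker : PadicInt.toZMod ((Λ γ : ℤ_[p]ˣ) : ℤ_[p]) = 1 := by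
      have h1 : Λp γ = 1 := hγ
      have h2 := congrArg Units.val h1
      simpa [Λp] using h2
    obtain ⟨s, hs⟩ := Iw.exists_w_mul_eq_one_of_toZMod_eq_one hker
    -- `Φ := γ`'s `Aut`-component satisfies `Φ ∘ χ₀ = χ₀ ∘ θ`; `θ (1,1) = (Λ γ, 1)`
    have hθ' : ∀ y, ((((γ : outerSemidirectProduct ρ') : contMulAut c.G × PA).1 : MulAut c.G))
        (χ₀.toMonoidHom y) = χ₀.toMonoidHom (θ y) := fun y => by rw [← hα]; exact hθ y
    have hθ1 : θ ⟨1, 0⟩ = ⟨(Λ γ : ℤ_[p]), 0⟩ := by rw [hθl, mul_one]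
    have hγH := ((hStmem _).1 γ.2).1
    have hγK := ((hStmem _).1 γ.2).2
    have htT : Iw.bHom (0 : ℤ_[p]) ⟨s⟩ ∈ (Iw.bHom (0 : ℤ_[p])).toMonoidHom.range := ⟨⟨s⟩, rfl⟩
    -- the element `δ = ι(χ₀ b_0(s)) · γ`
    refine ⟨toOuterSemidirectProduct ρ' (χ₀.toMonoidHom (Iw.bHom (0 : ℤ_[p]) ⟨s⟩)) *
        (γ : outerSemidirectProduct ρ'), Subgroup.mem_inf.mpr ⟨?_, ?_⟩, ?_⟩
    · -- `δ ∈ Π^temp_{𝔊,b₀}`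
      refine mem_arithBrGp_of_map_eq c ρ' Rc _ hb₀ ?_ ?_
      · rw [hH, Subgroup.coe_mul, Prod.fst_mul, Subgroup.coe_mul, SubgroupMulAut.map_mul, hγH]
        exact SubgroupMulAut.map_conj_of_mem ⟨_, rfl⟩
      · rw [hK, Subgroup.coe_mul, Prod.fst_mul, Subgroup.coe_mul, SubgroupMulAut.map_mul, hγK]
        exact SubgroupMulAut.map_conj_of_mem ⟨_, htT, rfl⟩
    · -- `δ ∈ g Π^temp_{𝔊,b₀} g⁻¹`: `g⁻¹ δ g` stabilises `χ₀ P` and `χ₀ T_0`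
      refine ⟨g⁻¹ * (toOuterSemidirectProduct ρ' (χ₀.toMonoidHom (Iw.bHom (0 : ℤ_[p]) ⟨s⟩)) *
          (γ : outerSemidirectProduct ρ')) * g,
        ?_, by rw [MulEquiv.coe_toMonoidHom, MulAut.conj_apply]; group⟩
      have hfst : (((g⁻¹ * (toOuterSemidirectProduct ρ' (χ₀.toMonoidHom (Iw.bHom (0 : ℤ_[p]) ⟨s⟩)) *
          (γ : outerSemidirectProduct ρ')) * g : outerSemidirectProduct ρ') : contMulAut c.G × PA).1 :
            MulAut c.G) =
          MulAut.conj (χ₀.toMonoidHom (⟨1, 0⟩ : Iw p)⁻¹) *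
            (MulAut.conj (χ₀.toMonoidHom (Iw.bHom (0 : ℤ_[p]) ⟨s⟩)) *
              (((γ : outerSemidirectProduct ρ') : contMulAut c.G × PA).1 : MulAut c.G)) *
            MulAut.conj (χ₀.toMonoidHom (⟨1, 0⟩ : Iw p)) := by
        rw [hgdef, ← map_inv, ← map_inv]; rfl
      refine mem_arithBrGp_of_map_eq c ρ' Rc _ hb₀ ?_ ?_
      · rw [hH, hfst, SubgroupMulAut.map_mul, SubgroupMulAut.map_mul, SubgroupMulAut.map_mul,
          SubgroupMulAut.map_conj_of_mem (S := χ₀.toMonoidHom.range) ⟨_, rfl⟩, hγH,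
          SubgroupMulAut.map_conj_of_mem (S := χ₀.toMonoidHom.range) ⟨_, rfl⟩,
          SubgroupMulAut.map_conj_of_mem (S := χ₀.toMonoidHom.range) ⟨_, rfl⟩]
      · rw [hK, hfst]
        exact Iw.map_realign_eq χ₀.toMonoidHom _ θ hθ' hθT hθ1 hs
    · -- `aug δ = aug γ`
      change ((toOuterSemidirectProduct ρ' (χ₀.toMonoidHom (Iw.bHom (0 : ℤ_[p]) ⟨s⟩)) *
          (γ : outerSemidirectProduct ρ') : outerSemidirectProduct ρ') : contMulAut c.G × PA).2 = _
      rw [Subgroup.coe_mul, Prod.snd_mul, toOuterSemidirectProduct_snd, one_mul]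
      rfl
  -- conclusion: clause (B) of Def 5.3 (ii) at `(b₀, v₀, g)` is violated
  have hample : IsArithAmple (outerSemidirectProductSnd ρ')
      (arithBrGp Rc (toOuterSemidirectProduct ρ') b₀ ⊓
        conjSubgroup g (arithBrGp Rc (toOuterSemidirectProduct ρ') b₀)) :=
    Subgroup.isOpen_mono hle hUopen
  exact (hest ((doubleLoop p).graph.edgeOf b₀) b₀ rfl v₀ hb₀ g hgv).2 hgb hample

/-- **`p = 2`: Def 5.3 (ii) fails at `𝒟₁ = doubleLoop 2` OUTRIGHT** — for every `Π_A`, every outer action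
under `hBR` + `noSwitchBase`, every `Rc`: the index hypothesis of
`not_isTotallyArithEstranged_doubleLoop_of_branchTransport` is vacuous (`index ∣ 1` forces the whole group,
which is open). [cite: MochizukiSemiAnbd2006, Def 5.3 (ii), p. 65] -/
theorem not_isTotallyArithEstranged_doubleLoop_of_branchTransport_of_eq_two [TopologicalSpace PA]
    [IsTopologicalGroup PA] (hp : p = 2) (Rc : ChartRepresentatives c) :
    ¬ IsTotallyArithEstranged (decompositionDataOfChart Rc (toOuterSemidirectProduct ρ'))
      (outerSemidirectProductSnd ρ') := by
  refine not_isTotallyArithEstranged_doubleLoop_of_branchTransport p c ρ' baseAct hBR noSwitchBase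
    (fun H hH => ?_) Rc
  subst hp
  rw [Nat.dvd_one, Subgroup.index_eq_one] at hH
  rw [hH, Subgroup.coe_top]
  exact isOpen_univ

/-- **Strongly complete `Π_A`**: if every finite-index subgroup of `Π_A` is open (e.g. `Π_A` a topologically
finitely generated profinite group, [NS]), Def 5.3 (ii) fails at `𝒟₁ = doubleLoop p` for every outer action
under `hBR` + `noSwitchBase` (when `p > 1`, a subgroup of index dividing `p − 1` has finite index).
[cite: MochizukiSemiAnbd2006, Def 5.3 (ii), p. 65] -/
theorem not_isTotallyArithEstranged_doubleLoop_of_branchTransport_of_finiteIndex_isOpen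
    [TopologicalSpace PA] [IsTopologicalGroup PA]
    (hfio : ∀ H : Subgroup PA, H.FiniteIndex → IsOpen (H : Set PA)) (Rc : ChartRepresentatives c) :
    ¬ IsTotallyArithEstranged (decompositionDataOfChart Rc (toOuterSemidirectProduct ρ'))
      (outerSemidirectProductSnd ρ') := by
  refine not_isTotallyArithEstranged_doubleLoop_of_branchTransport p c ρ' baseAct hBR noSwitchBase
    (fun H hH => hfio H ⟨fun h0 => ?_⟩) Rc
  rw [h0, zero_dvd_iff] at hH
  have hp : 1 < p := (Fact.out : p.Prime).one_lt
  omega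

end BranchTransport

end IwahoriWitness

end Literature.AnabelianGeometry.SemiGraphs
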